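import Literature.NumberTheory.LocalFields.UnramifiedQuadraticNormAtInertPlace        -- ★ sibling: inert-place API (`residueHom_galAdicCompletionMap_eq_pow`, `natCard_residueField_eq_sq_of_inert`)
import Literature.NumberTheory.GaloisCohomology.KummerClassLocalPower                  -- ★ Hensel: `exists_eq_pow_of_valuation_sub_one_lt`
import Literature.NumberTheory.Automorphic.SelfDualLatticeCountFrameTransportCM        -- ★ `valued_toPlace_uniformizer`, `galAdicCompletionMap_toPlace_self` (CM, `σ_w`-fixed uniformizer)
import Literature.NumberTheory.Automorphic.ValuedFieldValuativeRelBridge               -- ★ `v_eq_one_iff_valuation_eq_one`, `v_lt_one_iff_valuation_lt_one`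
import Literature.NumberTheory.Automorphic.IwahoriGL                                   -- ★ `residue_eq_zero_iff_valuation_lt_one`
import HarnessLib

/-!
# At an inert place with odd residue characteristic, `σ_w`-fixed units of `E_w` are SQUARES, and `σ_w`-fixed non-squares have ODD order
(Serre, *Local Fields*, Ch. V §2; Neukirch, ANT Ch. II (4.3), (5.7); O'Meara §63)

Topic `NumberTheory/LocalFields`; namespace `Literature.NumberTheory.LocalFields.UnramifiedQuadraticNorm` (sibling of ★ `UnramifiedQuadraticNormAtInertPlace`, same
§1 generic ∕ §2 number-field layout).  THEOREMS ONLY (no definition, no instance, no notation, no named fact, no `sorry`; count-neutral).  Cell `pub/hodgecm-mathlib`,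
F0∕P3a road «D-N7-inert», line «N7nsCount»: the local input of «`hirr` + unitarity ⇒ `ord_w disc χ_{g,w}` ODD» (B-p14 (g30) 2026-09-01T04:42:03Z, architect
A-p06 (g26)) for the type-(2) exponent stub ★ `exists_irredExponents`.  HONEST LABEL: HC_CM is proved only modulo the printed citations until rung 0 closes.

THE MATHEMATICS.  `E` a non-archimedean local field with residue field `𝓀` of order `q²` and odd characteristic, `σ` a ring endomorphism of `E` preserving `𝒪 = 𝒪[E]`
whose reduction is the `q`-Frobenius (the INERT quadratic situation `E = E_w ⊃ F_v`, `σ = σ_w`).  (§1) A `σ`-fixed unit `u` has Frobenius-fixed residue `ū`, so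
`ū^{q−1} = 1` and `ū^{(q²−1)/2} = (ū^{q−1})^{(q+1)/2} = 1`: `ū` is a SQUARE in `𝓀` (Euler's criterion, Mathlib `FiniteField.isSquare_iff`); by Hensel (`p` odd, ★
`exists_eq_pow_of_valuation_sub_one_lt`) `u` is a square in `E` (**`isSquare_coe_of_isUnit_of_map_eq`**).  (§2) At an inert place `w ∣ v` of a quadratic extension of
number fields: `σ_w`-fixed units of `E_w` — e.g. the units of `F_v` — are squares in `E_w` (**`isSquare_of_isUnit_of_galAdicCompletionMap_eq`**; the familiar
«`E_w ⊇ F_v(√u)` for every unit `u`, `E_w∕F_v` being THE unramified quadratic extension»).  (§3, CM) Since `ϖ_v` is a `σ_w`-fixed uniformizer of `L_w`, a `σ_w`-fixed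
element of EVEN order is a square (**`isSquare_of_galAdicCompletionMap_eq_of_even`**), so a `σ_w`-fixed NON-SQUARE has ODD order
(**`odd_log_valued_of_not_isSquare`**, **`exists_valued_eq_exp_neg_odd_of_not_isSquare`**).

## References
* [Serre1979] J.-P. Serre, *Local Fields*, GTM 67 (1979), Ch. V §2 Prop. 3 and Cor.; Ch. XIV §4.
* [NeukirchANT1999] J. Neukirch, *Algebraic Number Theory* (1999), Ch. II (4.3), (5.7)–(5.8).
* [Omeara1963] O. T. O'Meara, *Introduction to Quadratic Forms* (1963), §63 (local square classes; 63:1a).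
-/

set_option autoImplicit false

noncomputable section

open ValuativeRel NumberField IsDedekindDomain
open Literature.NumberTheory.LocalFields.UnramifiedQuadraticNorm Literature.NumberTheory.Automorphic Literature.NumberTheory.GaloisRepresentations
open Literature.NumberTheory.GaloisCohomology

namespace Literature.NumberTheory.LocalFields.UnramifiedQuadraticNorm

/-! ## §1 A non-archimedean local field with Frobenius reduction: fixed units are squares -/

section LocalField

variable {E : Type*} [Field E] [ValuativeRel E] [TopologicalSpace E] [IsNonarchimedeanLocalField E]
  (σ : E →+* E)

/-- **A Frobenius-fixed element of a field of order `q²` and odd characteristic is a square**: `σk y = y^q = y` gives `y^{q−1} = 1` (`y ≠ 0`), so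
`y^{(q²−1)/2} = (y^{q−1})^{(q+1)/2} = 1` — Euler's criterion. [cite: Serre1979, Ch. V §2] [cite: NeukirchANT1999, Ch. II (4.3)] -/
theorem isSquare_of_frobenius_eq_self (σk : 𝓀[E] →+* 𝓀[E]) {q : ℕ} (hk : Nat.card 𝓀[E] = q ^ 2) (hσq : ∀ x : 𝓀[E], σk x = x ^ q)
    (h2 : (2 : 𝓀[E]) ≠ 0) {y : 𝓀[E]} (hy : σk y = y) : IsSquare y := by
  classical
  letI : Fintype 𝓀[E] := Fintype.ofFinite _
  have hk' : Fintype.card 𝓀[E] = q ^ 2 := by rw [← Nat.card_eq_fintype_card, hk]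
  by_cases hy0 : y = 0
  · exact ⟨0, by rw [hy0, mul_zero]⟩
  have hchar : ringChar 𝓀[E] ≠ 2 := by
    intro h
    apply h2
    have h22 : ((2 : ℕ) : 𝓀[E]) = 0 := (ringChar.spec 𝓀[E] 2).2 (by rw [h])
    exact_mod_cast h22
  -- `q` is odd (a field of odd characteristic has odd cardinality `q²`)
  have hodd : q ^ 2 % 2 = 1 := by
    rw [← hk']
    rcases Nat.mod_two_eq_zero_or_one (Fintype.card 𝓀[E]) with h | h
    · exact absurd (FiniteField.even_card_iff_char_two.2 h) hchar
    · exact h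
  have hq : q % 2 = 1 := by
    rcases Nat.mod_two_eq_zero_or_one q with h | h
    · exfalso; rw [Nat.pow_mod, h] at hodd; norm_num at hodd
    · exact h
  -- `y^{q-1} = 1`
  have hyq : y ^ (q - 1) = 1 := by
    have h := hσq y
    rw [hy] at h
    have hq1 : q = (q - 1) + 1 := by omega
    have h' : y * y ^ (q - 1) = y * 1 := by
      rw [mul_one, ← pow_succ', ← hq1]; exact h.symm
    exact mul_left_cancel₀ hy0 h'
  rw [FiniteField.isSquare_iff hchar hy0, hk']
  have hdiv : q ^ 2 / 2 = (q - 1) * ((q + 1) / 2) := by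
    obtain ⟨m, rfl⟩ : ∃ m, q = 2 * m + 1 := ⟨q / 2, by omega⟩
    have e1 : (2 * m + 1) ^ 2 / 2 = 2 * m * m + 2 * m := by
      rw [show (2 * m + 1) ^ 2 = (2 * m * m + 2 * m) * 2 + 1 by ring]; omega
    have e2 : (2 * m + 1 + 1) / 2 = m + 1 := by omega
    rw [e1, e2, show 2 * m + 1 - 1 = 2 * m by omega]; ring
  rw [hdiv, pow_mul, hyq, one_pow]

/-- **HENSEL: a unit of `𝒪[E]` with SQUARE residue is a square in `E`** (`|2| = 1`): `ū = s̄²` with `s` a unit, `u∕s²` is a principal unit, hence a square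
(★ `exists_eq_pow_of_valuation_sub_one_lt 2`). [cite: NeukirchANT1999, Ch. II (5.7)–(5.8)] [cite: Omeara1963, §63 63:1a] -/
theorem isSquare_coe_of_isUnit_of_isSquare_residue (h2 : valuation E (2 : E) = 1) (u : 𝒪[E]) (hu : IsUnit u)
    (hsq : IsSquare (IsLocalRing.residue 𝒪[E] u)) : IsSquare (u : E) := by
  obtain ⟨sbar, hs⟩ := hsq
  obtain ⟨s, rfl⟩ := IsLocalRing.residue_surjective sbar
  have hubar : IsLocalRing.residue 𝒪[E] u ≠ 0 := (IsLocalRing.residue_ne_zero_iff_isUnit u).2 hu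
  have hsu : IsUnit s := by
    rw [← IsLocalRing.residue_ne_zero_iff_isUnit]
    intro h0
    apply hubar
    rw [hs, h0, mul_zero]
  have hvs : valuation E (s : E) = 1 := (Valuation.Integers.isUnit_iff_valuation_eq_one (Valuation.integer.integers _)).1 hsu
  have hs0 : (s : E) ≠ 0 := fun h0 => by rw [h0, map_zero] at hvs; exact zero_ne_one hvs
  -- `u − s²` has residue `0`, so valuation `< 1`
  have hlt : valuation E ((u : E) - (s : E) * (s : E)) < 1 := by
    have h0 : IsLocalRing.residue 𝒪[E] (u - s * s) = 0 := by rw [map_sub, map_mul, hs, sub_self]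
    have h := (residue_eq_zero_iff_valuation_lt_one (u - s * s)).1 h0
    simpa using h
  -- `x := u ∕ s²` is a principal unit
  have hx : valuation E ((u : E) / ((s : E) * (s : E)) - 1) < 1 := by
    have hss : (s : E) * (s : E) ≠ 0 := mul_ne_zero hs0 hs0
    rw [div_sub_one hss, map_div₀, map_mul, hvs, mul_one, div_one]
    exact hlt
  obtain ⟨t, ht⟩ := exists_eq_pow_of_valuation_sub_one_lt E 2 (by rw [Nat.cast_ofNat]; exact h2) hx
  refine ⟨t * (s : E), ?_⟩
  have hss : (s : E) * (s : E) ≠ 0 := mul_ne_zero hs0 hs0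
  calc (u : E) = (u : E) / ((s : E) * (s : E)) * ((s : E) * (s : E)) := (div_mul_cancel₀ _ hss).symm
    _ = t ^ 2 * ((s : E) * (s : E)) := by rw [ht]
    _ = t * (s : E) * (t * (s : E)) := by ring

/-- **A `σ`-FIXED UNIT IS A SQUARE** when `σ` reduces to the `q`-Frobenius of a residue field of order `q²` and `|2| = 1` (the inert quadratic situation): the residue is
Frobenius-fixed hence a square (`isSquare_of_frobenius_eq_self`), and Hensel lifts (`isSquare_coe_of_isUnit_of_isSquare_residue`).
[cite: Serre1979, Ch. V §2 Prop. 3 Cor.] [cite: NeukirchANT1999, Ch. II (4.3), (5.7)] -/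
theorem isSquare_coe_of_isUnit_of_map_eq (hσO : ∀ x : 𝒪[E], σ x ∈ 𝒪[E]) (σk : 𝓀[E] →+* 𝓀[E])
    (hσk : ∀ x : 𝒪[E], IsLocalRing.residue 𝒪[E] ⟨σ x, hσO x⟩ = σk (IsLocalRing.residue 𝒪[E] x))
    {q : ℕ} (hk : Nat.card 𝓀[E] = q ^ 2) (hσq : ∀ x : 𝓀[E], σk x = x ^ q) (h2 : valuation E (2 : E) = 1)
    (u : 𝒪[E]) (hu : IsUnit u) (hσu : σ u = u) : IsSquare (u : E) := by
  have h2O : IsUnit (2 : 𝒪[E]) := by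
    rw [(Valuation.Integers.isUnit_iff_valuation_eq_one (Valuation.integer.integers (valuation E))), map_ofNat]
    exact h2
  have h2k : (2 : 𝓀[E]) ≠ 0 := by
    have h := (IsLocalRing.residue_ne_zero_iff_isUnit (2 : 𝒪[E])).2 h2O
    rwa [map_ofNat] at h
  have hfix : σk (IsLocalRing.residue 𝒪[E] u) = IsLocalRing.residue 𝒪[E] u := by
    rw [← hσk]
    congr 1
    exact Subtype.ext hσu
  exact isSquare_coe_of_isUnit_of_isSquare_residue h2 u hu (isSquare_of_frobenius_eq_self σk hk hσq h2k hfix)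

end LocalField

/-! ## §2 The completion `E_w` at an INERT place of a quadratic extension of number fields: `σ_w`-fixed units are squares -/

section InertPlace

variable {F E : Type} [Field F] [NumberField F] [Field E] [NumberField E] [Algebra F E]
  [Algebra.IsQuadraticExtension F E] (c : E ≃ₐ[F] E) (v : HeightOneSpectrum (𝓞 F))

/-- **At an inert place, `σ_w`-fixed units of `E_w` are squares in `E_w`** (`c ≠ 1`, `v` unramified in `E`, `w ∣ v` with `c • w = w`, `|2|_w = 1`): in particular every
unit of `F_v` is a square in `E_w` — `E_w ⊇ F_v(√u)`, `E_w∕F_v` being THE unramified quadratic extension (★ §1 with `σ̄_w = Frob_{q_v}` ★ `residueHom_galAdicCompletionMap_eq_pow`,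
`|𝓀[E_w]| = q_v²` ★ `natCard_residueField_eq_sq_of_inert`). [cite: Serre1979, Ch. V §2 Prop. 3 Cor.] [cite: NeukirchANT1999, Ch. II (4.3), (5.7)] -/
theorem isSquare_of_isUnit_of_galAdicCompletionMap_eq (hc : c ≠ 1) (hv : Algebra.IsUnramifiedIn (𝓞 E) v.asIdeal)
    (w : UnitaryGroup.PlacesOver E v) (hw : c • w.1 = w.1) (h2 : Valued.v (2 : w.1.adicCompletion E) = 1)
    (u : 𝒪[w.1.adicCompletion E]) (hu : IsUnit u) (hσu : galAdicCompletionMap (L := E) c hw u = u) :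
    IsSquare (u : w.1.adicCompletion E) := by
  obtain ⟨σk, hσk⟩ := exists_residueField_ringHom_galAdicCompletionMap c v w hw
  exact isSquare_coe_of_isUnit_of_map_eq (galAdicCompletionMap (L := E) c hw) (mem_integer_galAdicCompletionMap c v w hw) σk hσk
    (natCard_residueField_eq_sq_of_inert c v hc hv w hw)
    (residueHom_galAdicCompletionMap_eq_pow c v hc hv w hw σk (mem_integer_galAdicCompletionMap c v w hw) hσk)
    ((v_eq_one_iff_valuation_eq_one _).1 h2) u hu hσu

/-- … for an element of `E_w` of valuation one (packaging `u` as a unit of `𝒪[E_w]`). [cite: Serre1979, Ch. V §2 Prop. 3 Cor.] -/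
theorem isSquare_of_valued_eq_one_of_galAdicCompletionMap_eq (hc : c ≠ 1) (hv : Algebra.IsUnramifiedIn (𝓞 E) v.asIdeal)
    (w : UnitaryGroup.PlacesOver E v) (hw : c • w.1 = w.1) (h2 : Valued.v (2 : w.1.adicCompletion E) = 1)
    {z : w.1.adicCompletion E} (hz : Valued.v z = 1) (hσz : galAdicCompletionMap (L := E) c hw z = z) : IsSquare z := by
  have hzO : z ∈ 𝒪[w.1.adicCompletion E] := (v_le_one_iff_mem_integer z).1 hz.le
  have hzu : IsUnit (⟨z, hzO⟩ : 𝒪[w.1.adicCompletion E]) := by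
    rw [(Valuation.Integers.isUnit_iff_valuation_eq_one (Valuation.integer.integers (valuation (w.1.adicCompletion E))))]
    exact (v_eq_one_iff_valuation_eq_one z).1 hz
  exact isSquare_of_isUnit_of_galAdicCompletionMap_eq c v hc hv w hw h2 ⟨z, hzO⟩ hzu hσz

end InertPlace

/-! ## §3 CM fields: a `σ_w`-fixed element of even order is a square; a `σ_w`-fixed non-square has odd order -/

section CM

variable (L : Type) [Field L] [NumberField L] [IsCMField L] (v : HeightOneSpectrum (𝓞 ↥(maximalRealSubfield L)))
  (w : UnitaryGroup.PlacesOver L v) (hw : IsCMField.complexConj L • w.1 = w.1)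

include hw in
/-- **A `σ_w`-fixed element of EVEN order is a square in `L_w`** (inert `v` with `|2|_w = 1`): `z = (z ϖ_v^{n}) · ϖ_v^{−n}` with `n = ord`-exponent even, `ϖ_v` a
`σ_w`-FIXED uniformizer of `L_w` (★ `valued_toPlace_uniformizer`, ★ `galAdicCompletionMap_toPlace_self`), and the `σ_w`-fixed unit `z ϖ_v^{n}` is a square by §2.
[cite: Serre1979, Ch. XIV §4] [cite: Omeara1963, §63] -/
theorem isSquare_of_galAdicCompletionMap_eq_of_even (hunr : Algebra.IsUnramifiedIn (𝓞 L) v.asIdeal) (h2 : Valued.v (2 : w.1.adicCompletion L) = 1)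
    {z : w.1.adicCompletion L} (hz0 : z ≠ 0) (hσz : galAdicCompletionMap (L := L) (IsCMField.complexConj L) hw z = z)
    (heven : Even (WithZero.log (Valued.v z))) : IsSquare z := by
  set σ := galAdicCompletionMap (L := L) (IsCMField.complexConj L) hw with hσ
  set ϖ : w.1.adicCompletion L :=
    UnitaryGroup.toPlace v w (HeckeCharacter.uniformizer ↥(maximalRealSubfield L) v : v.adicCompletion ↥(maximalRealSubfield L)) with hϖ
  have hϖ0 : ϖ ≠ 0 := UnitaryGroup.toPlace_uniformizer_ne_zero L v w hunr
  have hσϖ : σ ϖ = ϖ := UnitaryGroup.galAdicCompletionMap_toPlace_self L v w hw _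
  obtain ⟨m, hm⟩ := heven
  set n : ℤ := WithZero.log (Valued.v z) with hn
  have hvz : Valued.v z = WithZero.exp n := by rw [hn, WithZero.exp_log ((Valuation.ne_zero_iff _).2 hz0)]
  -- the `σ_w`-fixed unit `z ϖ^n`
  have hunit : Valued.v (z * ϖ ^ n) = 1 := by
    rw [map_mul, hvz, UnitaryGroup.valued_toPlace_uniformizer_zpow L v w hunr, ← WithZero.exp_add, add_neg_cancel, WithZero.exp_zero]
  have hfix : σ (z * ϖ ^ n) = z * ϖ ^ n := by rw [map_mul, map_zpow₀, hσz, hσϖ]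
  obtain ⟨t, ht⟩ := isSquare_of_valued_eq_one_of_galAdicCompletionMap_eq (IsCMField.complexConj L) v (IsCMField.complexConj_ne_one L) hunr w hw h2
    hunit hfix
  refine ⟨t * ϖ ^ (-m), ?_⟩
  have key : z = z * ϖ ^ n * ϖ ^ (-n) := by rw [mul_assoc, ← zpow_add₀ hϖ0, add_neg_cancel, zpow_zero, mul_one]
  rw [key, ht, hm, neg_add, zpow_add₀ hϖ0]
  ring

include hw in
/-- **A `σ_w`-FIXED NON-SQUARE OF `L_w` HAS ODD ORDER** (inert `v`, `|2|_w = 1`): `log v_w(z)` is odd (else §3 makes `z` a square).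
[cite: Serre1979, Ch. XIV §4] [cite: Omeara1963, §63] -/
theorem odd_log_valued_of_not_isSquare (hunr : Algebra.IsUnramifiedIn (𝓞 L) v.asIdeal) (h2 : Valued.v (2 : w.1.adicCompletion L) = 1)
    {z : w.1.adicCompletion L} (hσz : galAdicCompletionMap (L := L) (IsCMField.complexConj L) hw z = z) (hns : ¬ IsSquare z) :
    Odd (WithZero.log (Valued.v z)) := by
  have hz0 : z ≠ 0 := fun h0 => hns ⟨0, by rw [h0, mul_zero]⟩
  rw [← Int.not_even_iff_odd]
  exact fun heven => hns (isSquare_of_galAdicCompletionMap_eq_of_even L v w hw hunr h2 hz0 hσz heven)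

include hw in
/-- … for integral `z` (`v_w(z) ≤ 1`): `v_w(z) = exp(−(2N+1))` for some `N : ℕ`.  Applied to `z ∼ disc χ_{g,w} ∼ ι_w(k)` of the irreducible unitary block (★ B-p14
`exists_kappa_sq_eq_toLocalRing`, ★ `not_isSquare_of_kappa`) it gives the odd-order hypothesis `hN` of ★ `exists_irredExponents`. [cite: Serre1979, Ch. XIV §4] [cite: Omeara1963, §63] -/
theorem exists_valued_eq_exp_neg_odd_of_not_isSquare (hunr : Algebra.IsUnramifiedIn (𝓞 L) v.asIdeal) (h2 : Valued.v (2 : w.1.adicCompletion L) = 1)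
    {z : w.1.adicCompletion L} (hσz : galAdicCompletionMap (L := L) (IsCMField.complexConj L) hw z = z) (hns : ¬ IsSquare z) (hle : Valued.v z ≤ 1) :
    ∃ N : ℕ, Valued.v z = WithZero.exp (-((2 * N + 1 : ℕ) : ℤ)) := by
  have hz0 : z ≠ 0 := fun h0 => hns ⟨0, by rw [h0, mul_zero]⟩
  have hv0 : Valued.v z ≠ 0 := (Valuation.ne_zero_iff _).2 hz0
  have hle' : WithZero.log (Valued.v z) ≤ 0 := by
    rw [WithZero.log_le_iff_le_exp hv0, WithZero.exp_zero]; exact hle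
  obtain ⟨k, hk⟩ := odd_log_valued_of_not_isSquare L v w hw hunr h2 hσz hns
  refine ⟨(-k - 1).toNat, ?_⟩
  rw [← WithZero.exp_log hv0]
  congr 1
  push_cast
  rw [Int.toNat_of_nonneg (by omega)]
  omega

end CM

end Literature.NumberTheory.LocalFields.UnramifiedQuadraticNorm

end
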